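import Summits.ResolutionOfSingularities.ResolutionOfSingularities.Theorems.KeyChainLU3
import HarnessLib

/-!
# KeyChainLU4 — decomp-res node «KeyLadder» (lens-1 g21), tree file 4/5: key-chain local uniformization

Content VERBATIM from the decomp-res lens-1 g21 tree companion `HOME/decomp-res-lens-1/g21/tree/KeyChainLU.lean`
(sha 0edd4007, 1 331 l; = the node
`g21/KeyLadder.lean` a1145436 re-namespaced, typed against the LANDED `Theorems.WCut`, nothing inlined; farm rc 0 ·
0 err · 0 warn · 0 sorry, axioms
standard; HOME = run/shared/lean/pub/decomp-res).  Critic: CRITIC-LEDGER row 163 (DECIDED +1 · MAP 0: the kernel law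
`relLU_of_keyChainTop`, cell
`KeyChainTopBelow`, exact cuts of both `W`-halves; 2026-08-31T01:02:09Z); landing orders INBOX :625 / :633,
`g21/WRITER.md` 82b559ef.  Landed by
decomp-res writer g9 for the lens-1 column (host route `Valuative`, item `LuAlphaPTorsor` stmt-…-0641 — HELPER
files, no route edit) as
`KeyChainLU` / `KeyChainLU2` / … (PARTS I–VI, greedy ≤ 400-line packing, linear imports) and `KeyChainCut` (PART
VII, the split point named in
WRITER.md); namespace, sections, section variables / opens and every declaration exactly as in the companion (its
one global linter option dropped;
the companion lemma `valuation_algebraMap_eq_one` restated the landed `Literature…ELU.valuation_algebraMap_eq_one` —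
gate `dedup.landed` p800231 —
so the copy is dropped and its two uses cite the Literature lemma, import `EmbeddedLocalUniformization` in file 2).

-/

noncomputable section

open IsLocalRing Literature.AlgebraicGeometry.Resolution
open Summit.ResolutionOfSingularities.ResolutionOfSingularities.Theorems

namespace Summit.ResolutionOfSingularities.ResolutionOfSingularities.Theorems.KeyChainLU

section Law

variable {k : Type} [Field k] {K : Type} [Field K] [Algebra k K] {O : ValuationSubring K}
variable {g : ℕ → K} {e : ℕ → ℕ} {b : ℕ → ℕ →₀ ℤ} {ζ : ℕ → k}

/-- **THE REGULAR MODEL ADAPTED TO FINITELY MANY ELEMENTS.**  For a key chain and finitely many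
non-zero `x i ∈ k[y, z]` there is a finitely generated model `T ⊆ O` of `K`, regular (of dimension
`4`) at the centre, together with factorizations `x i = μ i · B i` (`μ i` a Laurent monomial in the
chain — the DOMINANT monomial of the complete expansion of `x i` —, `B i ∈ T` of value `1`) such
that `μ i / μ j ∈ T` whenever `v (x i) ≤ v (x j)`. [folklore] -/
theorem IsKeyChain.exists_regular_model (hK : IsKeyChain k O g e b ζ)
    (hk : ∀ c : k, algebraMap k K c ∈ O) {ι : Type} [Fintype ι] (x : ι → K)
    (hxP : ∀ i, x i ∈ Algebra.adjoin k (Set.range fun i : Fin 4 => g i)) (hx0 : ∀ i, x i ≠ 0) :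
    ∃ (T : Subalgebra k K) (hTO : T.toSubring ≤ O.toSubring), T.FG ∧ IsFractionRing T K ∧
      IsRegularLocalRing (Localization.AtPrime (centreIdeal T O hTO)) ∧
      ∃ (μ B : ι → K), (∀ i, B i ∈ T ∧ O.valuation (B i) = 1 ∧ x i = μ i * B i ∧ μ i ≠ 0) ∧
        ∀ i j, O.valuation (x i) ≤ O.valuation (x j) → μ i / μ j ∈ T := by
  classical
  have hg := hK.ne_zero
  -- COMPLETE EXPANSIONS of the `x i`
  have hexp : ∀ i, ∃ (N : ℕ) (c : Fin N → k) (β : Fin N → ℕ →₀ ℤ),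
      x i = ∑ t, algebraMap k K (c t) * mon g (β t) ∧
      ∀ t, O.valuation (algebraMap k K (c t) * mon g (β t)) ≤ O.valuation (x i) :=
    fun i => hK.complete (x i) (hxP i) (hx0 i)
  choose N cc ββ hxsum hxle' using hexp
  -- dominant terms
  have hdom : ∀ i, ∃ t₀, cc i t₀ ≠ 0 ∧ O.valuation (x i) = O.valuation (mon g (ββ i t₀)) ∧
      ∀ t, cc i t ≠ 0 → O.valuation (mon g (ββ i t)) ≤ O.valuation (mon g (ββ i t₀)) :=
    fun i => exists_dominant hk (hx0 i) (hxsum i) (hxle' i)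
  choose m hcm hvm hdm using hdom
  -- a common LEVEL `n ≥ 1` for all exponent vectors in sight
  obtain ⟨n, hn, hββn⟩ : ∃ n : ℕ, 1 ≤ n ∧ ∀ i t, Bdd (n + 3) (ββ i t) := by
    refine ⟨(Finset.univ.sup fun i : ι => Finset.univ.sup fun t : Fin (N i) =>
      (ββ i t).support.sup id) + 1, by omega, fun i t j hj => ?_⟩
    have h1 : j ≤ (ββ i t).support.sup id := Finset.le_sup (f := id) hj
    have h2 : (ββ i t).support.sup id ≤ Finset.univ.sup fun t : Fin (N i) =>
        (ββ i t).support.sup id := Finset.le_sup (f := fun t : Fin (N i) =>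
          (ββ i t).support.sup id) (Finset.mem_univ t)
    have h3 : (Finset.univ.sup fun t : Fin (N i) => (ββ i t).support.sup id) ≤
        Finset.univ.sup fun i : ι => Finset.univ.sup fun t : Fin (N i) =>
          (ββ i t).support.sup id := Finset.le_sup (f := fun i : ι =>
            Finset.univ.sup fun t : Fin (N i) => (ββ i t).support.sup id) (Finset.mem_univ i)
    omega
  -- THE D-LIST: frame and top; unit perturbations; term ratios; dominant ratios
  obtain ⟨D, hD₁, hD₂, hD₃, hD₄, hD⟩ : ∃ D : Finset (ℕ →₀ ℤ),
      (∀ i : Fin 4, Finsupp.single (i : ℕ) 1 ∈ D) ∧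
      (∀ l : ℕ, l + 1 < n → Finsupp.single (l + 4) 1 - b l ∈ D) ∧
      (∀ i t, cc i t ≠ 0 → ββ i t - ββ i (m i) ∈ D) ∧
      (∀ i j, O.valuation (x i) ≤ O.valuation (x j) → ββ i (m i) - ββ j (m j) ∈ D) ∧
      ∀ d ∈ D, Bdd (n + 3) d ∧ O.valuation (mon g d) ≤ 1 := by
    refine ⟨(Finset.univ.image fun i : Fin 4 => Finsupp.single (i : ℕ) 1) ∪
      ((Finset.range n).filter fun l => l + 1 < n).image (fun l => Finsupp.single (l + 4) 1 - b l) ∪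
      (((Finset.univ : Finset (Σ i : ι, Fin (N i))).filter fun p => cc p.1 p.2 ≠ 0).image
        fun p => ββ p.1 p.2 - ββ p.1 (m p.1)) ∪
      (((Finset.univ : Finset (ι × ι)).filter fun p => O.valuation (x p.1) ≤
        O.valuation (x p.2)).image fun p => ββ p.1 (m p.1) - ββ p.2 (m p.2)),
      fun i => ?_, fun l hl => ?_, fun i t ht => ?_, fun i j hij => ?_, fun d hd => ?_⟩
    · exact Finset.mem_union_left _ (Finset.mem_union_left _ (Finset.mem_union_left _
        (Finset.mem_image_of_mem _ (Finset.mem_univ i))))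
    · exact Finset.mem_union_left _ (Finset.mem_union_left _ (Finset.mem_union_right _
        (Finset.mem_image_of_mem _ (Finset.mem_filter.mpr ⟨Finset.mem_range.mpr (by omega), hl⟩))))
    · exact Finset.mem_union_left _ (Finset.mem_union_right _ (Finset.mem_image.mpr
        ⟨⟨i, t⟩, Finset.mem_filter.mpr ⟨Finset.mem_univ _, ht⟩, rfl⟩))
    · exact Finset.mem_union_right _ (Finset.mem_image.mpr
        ⟨⟨i, j⟩, Finset.mem_filter.mpr ⟨Finset.mem_univ _, hij⟩, rfl⟩)
    · rcases Finset.mem_union.mp hd with hd | hd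
      · rcases Finset.mem_union.mp hd with hd | hd
        · rcases Finset.mem_union.mp hd with hd | hd
          · obtain ⟨i, -, rfl⟩ := Finset.mem_image.mp hd
            refine ⟨bdd_single (by omega) 1, ?_⟩
            rw [mon_single, zpow_one]
            exact hK.le_one i
          · obtain ⟨l, hl, rfl⟩ := Finset.mem_image.mp hd
            have hl' := (Finset.mem_filter.mp hl).2
            refine ⟨bdd_sub (bdd_single (by omega) 1) (bdd_mono (by omega) (hK.b_lt l)), ?_⟩
            rw [mon_sub hg, mon_single, zpow_one, ← hK.Zee_sub]
            exact (hK.valuation_Zee_sub_lt l).le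
        · obtain ⟨⟨i, t⟩, ht, rfl⟩ := Finset.mem_image.mp hd
          have ht' : cc i t ≠ 0 := (Finset.mem_filter.mp ht).2
          refine ⟨bdd_sub (hββn i t) (hββn i (m i)), ?_⟩
          rw [mon_sub hg, map_div₀, div_le_one₀ ((Valuation.pos_iff _).mpr (mon_ne_zero hg _))]
          exact hdm i t ht'
      · obtain ⟨⟨i, j⟩, hij, rfl⟩ := Finset.mem_image.mp hd
        have hij' : O.valuation (x i) ≤ O.valuation (x j) := (Finset.mem_filter.mp hij).2
        refine ⟨bdd_sub (hββn _ _) (hββn _ _), ?_⟩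
        rw [mon_sub hg, map_div₀, div_le_one₀ ((Valuation.pos_iff _).mpr (mon_ne_zero hg _)),
          ← hvm, ← hvm]
        exact hij'
  -- THE CHART
  obtain ⟨r, Y, hr, hY, hrep⟩ := hK.exists_chart n D hD
  obtain ⟨Y', hY'def⟩ : ∃ Y' : Fin r → K, Y' = fun t => mon g (Y t) := ⟨_, rfl⟩
  have hY'1 : ∀ t, O.valuation (Y' t) < 1 := fun t => by rw [hY'def]; exact (hY t).2
  have honest : ∀ d ∈ D, Honest g e b n Y' (mon g d) := by
    intro d hd
    obtain ⟨c, u, hu, hcu⟩ := hrep d hd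
    exact ⟨c, u, hu, by rw [hY'def]; exact hcu⟩
  have hframe : ∀ i, i < 4 → Honest g e b n Y' (g i) := by
    intro i hi
    have := honest _ (hD₁ ⟨i, hi⟩)
    rwa [mon_single, zpow_one] at this
  have hunit : ∀ l, l + 1 < n → Honest g e b n Y' (Zee g e b l - algebraMap k K (ζ l)) := by
    intro l hl
    have := honest _ (hD₂ l hl)
    rwa [mon_sub hg, mon_single, zpow_one, ← hK.Zee_sub] at this
  -- THE MODEL `T` and its regularity at the centre
  obtain ⟨hfrT, hreg⟩ := hK.model_regular hk hn hr hY'1 hframe hunit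
  refine ⟨model k g e b n Y', model_le_O hK hk hY'1, model_fg n Y', hfrT, hreg,
    fun i => mon g (ββ i (m i)), fun i => ∑ t, algebraMap k K (cc i t) * mon g (ββ i t - ββ i (m i)),
    fun i => ?_, fun i j hij => ?_⟩
  · -- the BRACKET `x i = μ i · B i`
    have hfac : x i = mon g (ββ i (m i)) *
        ∑ t, algebraMap k K (cc i t) * mon g (ββ i t - ββ i (m i)) := by
      rw [Finset.mul_sum]
      conv_lhs => rw [hxsum i]
      refine Finset.sum_congr rfl fun t _ => ?_
      rw [mon_sub hg]
      conv_rhs => rw [mul_comm, mul_assoc, div_mul_cancel₀ _ (mon_ne_zero hg _)]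
    refine ⟨?_, ?_, hfac, mon_ne_zero hg _⟩
    · refine Subalgebra.sum_mem _ fun t _ => ?_
      by_cases ht : cc i t = 0
      · rw [ht, map_zero, zero_mul]
        exact Subalgebra.zero_mem _
      · exact Subalgebra.mul_mem _ (Subalgebra.algebraMap_mem _ _)
          (mem_model_of_honest (honest _ (hD₃ i t ht)))
    · have hv := hvm i
      conv_lhs at hv => rw [hfac, map_mul]
      have hne : O.valuation (mon g (ββ i (m i))) ≠ 0 :=
        (Valuation.ne_zero_iff _).mpr (mon_ne_zero hg _)
      have hv' : O.valuation (mon g (ββ i (m i))) *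
          O.valuation (∑ t, algebraMap k K (cc i t) * mon g (ββ i t - ββ i (m i))) =
            O.valuation (mon g (ββ i (m i))) * 1 := by rw [mul_one]; exact hv
      exact mul_left_cancel₀ hne hv'
  · -- dominant ratios
    rw [← mon_sub hg]
    exact mem_model_of_honest (honest _ (hD₄ i j hij))

/-- **THE LAW (kernel theorem, hypothesis-free).**  A valued function field carrying an inductive
binomial key chain over a monomial `3`-frame admits relative local uniformization:
`KeyChainTopBelow k O → RelLocalUniformization k K O`. [folklore] -/
theorem relLU_of_keyChainTop (h : KeyChainTopBelow k O) : RelLocalUniformization k K O := by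
  classical
  obtain ⟨g, e, b, ζ, hK⟩ := h
  have hg := hK.ne_zero
  intro R hRfg hRfr hRO
  have hk : ∀ c : k, algebraMap k K c ∈ O := algebraMap_mem_of_le O R hRO
  obtain ⟨S₀, hS₀⟩ := hRfg
  -- `P = k[y, z]`, `Frac P = K`
  set P : Subalgebra k K := Algebra.adjoin k (Set.range fun i : Fin 4 => g i) with hPdef
  haveI hfrP : IsFractionRing P K := by
    refine IsFractionRing.of_field _ K fun z => ?_
    have hz : z ∈ IntermediateField.adjoin k (Set.range fun i : Fin 4 => g i) := by
      rw [hK.adjoin_eq_top]; trivial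
    rw [IntermediateField.mem_adjoin_iff_div] at hz
    obtain ⟨a, ha, c, hc, rfl⟩ := hz
    exact ⟨⟨a, ha⟩, ⟨c, hc⟩, rfl⟩
  -- numerators and denominators of the targets
  have hfrac : ∀ s : S₀, ∃ a c : K, a ∈ P ∧ c ∈ P ∧ c ≠ 0 ∧ (s : K) = a / c := by
    intro s
    obtain ⟨a, c, hc, hs⟩ := IsFractionRing.div_surjective (A := P) (s : K)
    exact ⟨a, c, a.2, c.2, fun h0 => nonZeroDivisors.ne_zero hc (Subtype.ext h0), hs.symm⟩
  choose nu de hnuP hdeP hde0 hfrac using hfrac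
  have hsO : ∀ s : S₀, (s : K) ∈ O := fun s =>
    hRO (show (s : K) ∈ R from hS₀ ▸ Algebra.subset_adjoin s.2)
  have hnude : ∀ s : S₀, O.valuation (nu s) ≤ O.valuation (de s) := by
    intro s
    have h1 : O.valuation (nu s / de s) ≤ 1 := by
      rw [← hfrac s]
      exact (O.valuation_le_one_iff _).mpr (hsO s)
    rwa [map_div₀, div_le_one₀ ((Valuation.pos_iff _).mpr (hde0 s))] at h1
  -- the finite family of NON-ZERO elements of `P` to be expanded: numerators (replaced by the
  -- denominator when zero) and denominators
  obtain ⟨x, hxdef⟩ : ∃ x : S₀ ⊕ S₀ → K,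
      x = Sum.elim (fun s => if nu s = 0 then de s else nu s) fun s => de s := ⟨_, rfl⟩
  have hx1 : ∀ s, nu s ≠ 0 → x (Sum.inl s) = nu s := fun s h => by
    rw [hxdef]
    exact if_neg h
  have hx1' : ∀ s, nu s = 0 → x (Sum.inl s) = de s := fun s h => by
    rw [hxdef]
    exact if_pos h
  have hx2 : ∀ s, x (Sum.inr s) = de s := fun s => by rw [hxdef]; rfl
  have hxP : ∀ i, x i ∈ P := by
    rintro (s | s)
    · by_cases h : nu s = 0
      · rw [hx1' s h]; exact hdeP s
      · rw [hx1 s h]; exact hnuP s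
    · rw [hx2]; exact hdeP s
  have hx0 : ∀ i, x i ≠ 0 := by
    rintro (s | s)
    · by_cases h : nu s = 0
      · rw [hx1' s h]; exact hde0 s
      · rw [hx1 s h]; exact h
    · rw [hx2]; exact hde0 s
  have hxle : ∀ s : S₀, O.valuation (x (Sum.inl s)) ≤ O.valuation (x (Sum.inr s)) := by
    intro s
    by_cases h : nu s = 0
    · rw [hx1' s h, hx2]
    · rw [hx1 s h, hx2]; exact hnude s
  -- THE REGULAR MODEL adapted to the family
  obtain ⟨T, hTO, hTfg, hfrT, hreg, μ, B, hB, hμ⟩ := hK.exists_regular_model hk x hxP hx0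
  have hB0 : ∀ i, B i ≠ 0 := fun i h0 => by
    have := (hB i).2.1
    rw [h0, map_zero] at this
    exact zero_ne_one this
  obtain ⟨TS, hTS⟩ := hTfg
  -- THE REFINED MODEL `A = T[S₀]`
  set A : Subalgebra k K := Algebra.adjoin k ((TS : Set K) ∪ (S₀ : Set K)) with hAdef
  have hTA : T ≤ A := by
    rw [← hTS]
    exact Algebra.adjoin_mono Set.subset_union_left
  have hRA : R ≤ A := by
    rw [← hS₀]
    exact Algebra.adjoin_mono Set.subset_union_right
  have hTSsub : ∀ y ∈ (TS : Set K), y ∈ T := fun y hy => hTS ▸ Algebra.subset_adjoin hy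
  have hAO : A.toSubring ≤ O.toSubring := by
    refine adjoin_toSubring_le hk ?_
    rintro y (hy | hy)
    · exact hTO (hTSsub y hy)
    · exact hsO ⟨y, hy⟩
  have hAfg : A.FG := ⟨TS ∪ S₀, by rw [Finset.coe_union]⟩
  -- the sandwich condition `A ⊆ T_𝔮`
  have hQ : ∀ y (hy : y ∈ A), ∃ a', a' ∈ T ∧ ∃ s', s' ∈ T ∧ O.valuation s' = 1 ∧ y * s' = a' := by
    intro y hy
    refine Algebra.adjoin_induction (p := fun y _ => ∃ a', a' ∈ T ∧ ∃ s', s' ∈ T ∧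
      O.valuation s' = 1 ∧ y * s' = a') ?_ ?_ ?_ ?_ hy
    · rintro y (hy | hy)
      · exact ⟨y, hTSsub y hy, 1, Subalgebra.one_mem _, map_one _, mul_one y⟩
      · -- a TARGET `y = s ∈ S₀`
        set s : S₀ := ⟨y, hy⟩ with hsdef
        by_cases h0 : nu s = 0
        · refine ⟨0, Subalgebra.zero_mem _, 1, Subalgebra.one_mem _, map_one _, ?_⟩
          rw [show y = (s : K) from rfl, hfrac s, h0, zero_div, zero_mul]
        · refine ⟨μ (Sum.inl s) / μ (Sum.inr s) * B (Sum.inl s),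
            Subalgebra.mul_mem _ (hμ _ _ (hxle s)) (hB _).1, B (Sum.inr s), (hB _).1, (hB _).2.1, ?_⟩
          rw [show y = (s : K) from rfl, hfrac s, ← hx1 s h0, ← hx2 s, (hB (Sum.inl s)).2.2.1,
            (hB (Sum.inr s)).2.2.1]
          have h1 := (hB (Sum.inr s)).2.2.2
          have h2 := hB0 (Sum.inr s)
          field_simp
    · intro c
      exact ⟨algebraMap k K c, Subalgebra.algebraMap_mem _ c, 1, Subalgebra.one_mem _, map_one _,
        mul_one _⟩
    · rintro y₁ y₂ - - ⟨a₁, ha₁, s₁, hs₁, hv₁, h₁⟩ ⟨a₂, ha₂, s₂, hs₂, hv₂, h₂⟩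
      refine ⟨a₁ * s₂ + a₂ * s₁, Subalgebra.add_mem _ (Subalgebra.mul_mem _ ha₁ hs₂)
        (Subalgebra.mul_mem _ ha₂ hs₁), s₁ * s₂, Subalgebra.mul_mem _ hs₁ hs₂,
        by rw [map_mul, hv₁, hv₂, one_mul], ?_⟩
      linear_combination s₂ * h₁ + s₁ * h₂
    · rintro y₁ y₂ - - ⟨a₁, ha₁, s₁, hs₁, hv₁, h₁⟩ ⟨a₂, ha₂, s₂, hs₂, hv₂, h₂⟩
      refine ⟨a₁ * a₂, Subalgebra.mul_mem _ ha₁ ha₂, s₁ * s₂, Subalgebra.mul_mem _ hs₁ hs₂,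
        by rw [map_mul, hv₁, hv₂, one_mul], ?_⟩
      linear_combination (y₂ * s₂) * h₁ + a₁ * h₂
  -- CONCLUSION by the sandwich `T ⊆ A ⊆ T_𝔮`
  refine ⟨A, hAO, hRA, hAfg, ?_⟩
  have hle : T.toSubring ≤ A.toSubring := fun t ht => hTA ht
  haveI hfr : IsFractionRing T.toSubring K := hfrT
  refine @isRegularLocalRing_localization_of_sandwich K _ T.toSubring A.toSubring hle hfr
    (centreIdeal A O hAO) (centreIdeal.isPrime A O hAO) (centreIdeal T O hTO)
    (centreIdeal.isPrime T O hTO) ?_ ?_ hreg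
  · change Ideal.comap _ (Ideal.comap _ _) = Ideal.comap _ _
    rw [Ideal.comap_comap]
    exact congrArg (fun f => Ideal.comap f (IsLocalRing.maximalIdeal O)) (RingHom.ext fun _ => rfl)
  · intro t
    obtain ⟨a', ha', s', hs', hv1, hts⟩ := hQ t.1 t.2
    refine ⟨⟨a', ha'⟩, ⟨s', hs'⟩, ?_, hts⟩
    change (⟨s', _⟩ : A.toSubring) ∉ Ideal.comap _ (IsLocalRing.maximalIdeal O)
    rw [Ideal.mem_comap]
    intro hmem
    have hlt : O.valuation s' < 1 := (ValuationSubring.valuation_lt_one_iff O _).mp hmem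
    rw [hv1] at hlt
    exact lt_irrefl _ hlt

end Law

end Summit.ResolutionOfSingularities.ResolutionOfSingularities.Theorems.KeyChainLU
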